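import Mathlib
import Summits.ValiantsHypothesis.ValiantsHypothesis.Theorems.NewtonUnitEquationsDissociatedUniformTotalsLawChartTops
import Summits.ValiantsHypothesis.ValiantsHypothesis.Theorems.NewtonUnitEquationsDissociatedUniformTotalsLawChartLevels
import HarnessLib

/-!
# Crux `NewtonUnitEquations.DissociatedUniform` (stmt-ValiantsHypothesis-5905): totals law — top-`k` sets along a chart change only at low tie events

Companion of `…TotalsLawChartLevels` (`crossT`, `above`, `tied`, `IsLowEvent`, `lowEvents`, `topTies`, `card_topTies_le`).
Here: `rank σ F t p` (number of points of `F` strictly above `p` at chart time `t`), `topSet σ F k t = {p ∈ F : rank < k}`, and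
**`exists_lowEvent_of_topSet_ne`**: if `topSet σ F k t₁ ≠ topSet σ F k t₂` for `t₁ ≤ t₂` then some low tie event of order `< k`
(two points tie with `< k` points strictly above) happens at a time in `[t₁, t₂]` — by a first-crossing / last-crossing argument
(`exists_lowEvent_of_rank_lt_of_le`, `exists_lowEvent_of_le_of_rank_lt`) that needs no general position.  Consequently the top-`k`
set takes at most `1 + #lowEvents σ F k` distinct values along the chart; with the Clarkson–Shor count of low events this is the
`(≤ k)`-level bound used by memo `Cruxes/DissociatedUniform/NOTES-t1g4.md` §4 (R3).
Honest label: tool lemmas only; nothing here bears on VP ≠ VNP.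
[folklore: levels in arrangements of lines]
-/

set_option linter.dupNamespace false -- `ValiantsHypothesis.ValiantsHypothesis` (summit = problem) in every name

open scoped BigOperators

namespace Summit.ValiantsHypothesis.ValiantsHypothesis.Theorems.NewtonUnitEquationsDissociatedUniform

namespace TotalsLaw

open Literature.Computability.AlgebraicComplexity.KPTT.PlanarMinkowski

/-! ### Top-`k` sets change only at low events -/

section TopSets

variable (σ : ℝ) (F : Finset (Fin 2 → ℝ))

/-- The RANK of `p` at time `t`: the number of points of `F` strictly above it. -/
noncomputable def rank (t : ℝ) (p : Fin 2 → ℝ) : ℕ := (F.filter fun q => ![σ, t] ⬝ᵥ p < ![σ, t] ⬝ᵥ q).card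

/-- The TOP-`k` SET at time `t`: the points of `F` with fewer than `k` points strictly above. -/
noncomputable def topSet (k : ℕ) (t : ℝ) : Finset (Fin 2 → ℝ) := F.filter fun p => rank σ F t p < k

variable {σ F}

/-- First-crossing lemma: if `p ∈ F` has fewer than `k` points above at `t₁` but at least `k` at a later time `t₂`, then a low
event of order `< k` (with `p` in its tie group) happens in `[t₁, t₂]`. [folklore] -/
theorem exists_lowEvent_of_rank_lt_of_le {k : ℕ} {t₁ t₂ : ℝ} (h12 : t₁ ≤ t₂) {p : Fin 2 → ℝ} (hp : p ∈ F)
    (h1 : rank σ F t₁ p < k) (h2 : k ≤ rank σ F t₂ p) :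
    ∃ e : ℝ × ℝ, IsLowEvent σ F k e ∧ t₁ ≤ e.1 ∧ e.1 ≤ t₂ := by
  classical
  set S₁ := F.filter fun q => ![σ, t₁] ⬝ᵥ p < ![σ, t₁] ⬝ᵥ q with hS₁
  set S₂ := F.filter fun q => ![σ, t₂] ⬝ᵥ p < ![σ, t₂] ⬝ᵥ q with hS₂
  have hc1 : S₁.card < k := h1
  have hc2 : k ≤ S₂.card := h2
  -- the points that overtake `p` between `t₁` and `t₂`
  set D := S₂.filter fun q => q ∉ S₁ with hD
  have hDne : D.Nonempty := by
    by_contra hDe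
    rw [Finset.not_nonempty_iff_eq_empty] at hDe
    have hsub : S₂ ⊆ S₁ := by
      intro q hq
      by_contra hq1
      have : q ∈ D := Finset.mem_filter.2 ⟨hq, hq1⟩
      rw [hDe] at this
      exact absurd this (Finset.notMem_empty q)
    have := Finset.card_le_card hsub
    omega
  -- facts about members of `D`
  have hDfacts : ∀ q ∈ D, q ∈ F ∧ ![σ, t₁] ⬝ᵥ q ≤ ![σ, t₁] ⬝ᵥ p ∧ ![σ, t₂] ⬝ᵥ p < ![σ, t₂] ⬝ᵥ q ∧ p 1 < q 1 := by
    intro q hq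
    obtain ⟨hq2, hq1⟩ := Finset.mem_filter.1 hq
    obtain ⟨hqF, hlt2⟩ := Finset.mem_filter.1 hq2
    have hle1 : ![σ, t₁] ⬝ᵥ q ≤ ![σ, t₁] ⬝ᵥ p := by
      by_contra hh
      exact hq1 (Finset.mem_filter.2 ⟨hqF, lt_of_not_ge hh⟩)
    have ha := chart_dotProduct_sub_affine σ t₂ t₁ q p
    have hslope : p 1 < q 1 := by
      by_contra hh
      push Not at hh
      have : (t₂ - t₁) * (q 1 - p 1) ≤ 0 := mul_nonpos_of_nonneg_of_nonpos (by linarith) (by linarith)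
      linarith
    exact ⟨hqF, hle1, hlt2, hslope⟩
  -- the first crossing
  obtain ⟨q, hqD, hqmin⟩ := D.exists_min_image (fun q => crossT σ q p) hDne
  obtain ⟨hqF, hq1, hq2, hqs⟩ := hDfacts q hqD
  have hs : q 1 ≠ p 1 := ne_of_gt hqs
  set τ := crossT σ q p with hτ
  have htie : ![σ, τ] ⬝ᵥ q = ![σ, τ] ⬝ᵥ p := chart_eq_at_crossT σ hs
  -- `τ ∈ [t₁, t₂]`
  have hτ1 : t₁ ≤ τ := by
    by_contra hh
    push Not at hh
    have ha := chart_dotProduct_sub_affine σ t₁ τ q p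
    have : (t₁ - τ) * (q 1 - p 1) > 0 := mul_pos (by linarith) (by linarith)
    linarith
  have hτ2 : τ ≤ t₂ := by
    by_contra hh
    push Not at hh
    have ha := chart_dotProduct_sub_affine σ t₂ τ q p
    have : (t₂ - τ) * (q 1 - p 1) < 0 := mul_neg_of_neg_of_pos (by linarith) (by linarith)
    linarith
  refine ⟨(τ, ![σ, τ] ⬝ᵥ p), ⟨?_, ?_⟩, hτ1, hτ2⟩
  · -- two tied points: `p` and `q`
    have hqp : q ≠ p := fun h => by rw [h] at hqs; exact lt_irrefl _ hqs
    have hsub : ({q, p} : Finset (Fin 2 → ℝ)) ⊆ tied σ F τ (![σ, τ] ⬝ᵥ p) := by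
      intro y hy
      rw [Finset.mem_insert, Finset.mem_singleton] at hy
      rw [tied, Finset.mem_filter]
      rcases hy with rfl | rfl
      · exact ⟨hqF, htie⟩
      · exact ⟨hp, rfl⟩
    have := Finset.card_le_card hsub
    rw [Finset.card_pair hqp] at this
    exact this
  · -- everything above `p` at `τ` was already above at `t₁`
    have hsub : above σ F τ (![σ, τ] ⬝ᵥ p) ⊆ S₁ := by
      intro y hy
      obtain ⟨hyF, hylt⟩ := Finset.mem_filter.1 hy
      by_contra hy1
      have hle1 : ![σ, t₁] ⬝ᵥ y ≤ ![σ, t₁] ⬝ᵥ p := by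
        by_contra hh
        exact hy1 (Finset.mem_filter.2 ⟨hyF, lt_of_not_ge hh⟩)
      -- `y` crosses `p` upwards strictly before `τ`, hence belongs to `D` with a smaller crossing time
      have ha := chart_dotProduct_sub_affine σ τ t₁ y p
      have hys : p 1 < y 1 := by
        by_contra hh
        push Not at hh
        have : (τ - t₁) * (y 1 - p 1) ≤ 0 := mul_nonpos_of_nonneg_of_nonpos (by linarith) (by linarith)
        linarith
      have hys' : y 1 ≠ p 1 := ne_of_gt hys
      have ha2 := chart_dotProduct_sub_affine σ t₂ τ y p
      have hy2 : ![σ, t₂] ⬝ᵥ p < ![σ, t₂] ⬝ᵥ y := by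
        have : 0 ≤ (t₂ - τ) * (y 1 - p 1) := mul_nonneg (by linarith) (by linarith)
        linarith
      have hyD : y ∈ D := Finset.mem_filter.2 ⟨Finset.mem_filter.2 ⟨hyF, hy2⟩, hy1⟩
      have hmin := hqmin y hyD
      -- but the crossing time of `y` is strictly before `τ`
      have hcy := chart_eq_at_crossT σ hys'
      have ha3 := chart_dotProduct_sub_affine σ τ (crossT σ y p) y p
      have : (τ - crossT σ y p) * (y 1 - p 1) > 0 := by linarith
      have hlt : crossT σ y p < τ := by
        by_contra hh
        push Not at hh
        have : (τ - crossT σ y p) * (y 1 - p 1) ≤ 0 := mul_nonpos_of_nonpos_of_nonneg (by linarith) (by linarith)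
        linarith
      exact absurd hmin (not_le.2 hlt)
    exact lt_of_le_of_lt (Finset.card_le_card hsub) hc1

/-- Last-crossing lemma (time-reversed form): if `p ∈ F` has at least `k` points above at `t₁` but fewer than `k` at a later
time `t₂`, then a low event of order `< k` happens in `[t₁, t₂]`. [folklore] -/
theorem exists_lowEvent_of_le_of_rank_lt {k : ℕ} {t₁ t₂ : ℝ} (h12 : t₁ ≤ t₂) {p : Fin 2 → ℝ} (hp : p ∈ F)
    (h1 : k ≤ rank σ F t₁ p) (h2 : rank σ F t₂ p < k) :
    ∃ e : ℝ × ℝ, IsLowEvent σ F k e ∧ t₁ ≤ e.1 ∧ e.1 ≤ t₂ := by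
  classical
  set S₁ := F.filter fun q => ![σ, t₁] ⬝ᵥ p < ![σ, t₁] ⬝ᵥ q with hS₁
  set S₂ := F.filter fun q => ![σ, t₂] ⬝ᵥ p < ![σ, t₂] ⬝ᵥ q with hS₂
  have hc1 : k ≤ S₁.card := h1
  have hc2 : S₂.card < k := h2
  set D := S₁.filter fun q => q ∉ S₂ with hD
  have hDne : D.Nonempty := by
    by_contra hDe
    rw [Finset.not_nonempty_iff_eq_empty] at hDe
    have hsub : S₁ ⊆ S₂ := by
      intro q hq
      by_contra hq2
      have : q ∈ D := Finset.mem_filter.2 ⟨hq, hq2⟩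
      rw [hDe] at this
      exact absurd this (Finset.notMem_empty q)
    have := Finset.card_le_card hsub
    omega
  have hDfacts : ∀ q ∈ D, q ∈ F ∧ ![σ, t₁] ⬝ᵥ p < ![σ, t₁] ⬝ᵥ q ∧ ![σ, t₂] ⬝ᵥ q ≤ ![σ, t₂] ⬝ᵥ p ∧ q 1 < p 1 := by
    intro q hq
    obtain ⟨hq1, hq2⟩ := Finset.mem_filter.1 hq
    obtain ⟨hqF, hlt1⟩ := Finset.mem_filter.1 hq1
    have hle2 : ![σ, t₂] ⬝ᵥ q ≤ ![σ, t₂] ⬝ᵥ p := by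
      by_contra hh
      exact hq2 (Finset.mem_filter.2 ⟨hqF, lt_of_not_ge hh⟩)
    have ha := chart_dotProduct_sub_affine σ t₂ t₁ q p
    have hslope : q 1 < p 1 := by
      by_contra hh
      push Not at hh
      have : 0 ≤ (t₂ - t₁) * (q 1 - p 1) := mul_nonneg (by linarith) (by linarith)
      linarith
    exact ⟨hqF, hlt1, hle2, hslope⟩
  -- the last crossing
  obtain ⟨q, hqD, hqmax⟩ := D.exists_max_image (fun q => crossT σ q p) hDne
  obtain ⟨hqF, hq1, hq2, hqs⟩ := hDfacts q hqD
  have hs : q 1 ≠ p 1 := ne_of_lt hqs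
  set τ := crossT σ q p with hτ
  have htie : ![σ, τ] ⬝ᵥ q = ![σ, τ] ⬝ᵥ p := chart_eq_at_crossT σ hs
  have hτ1 : t₁ ≤ τ := by
    by_contra hh
    push Not at hh
    have ha := chart_dotProduct_sub_affine σ t₁ τ q p
    have : (t₁ - τ) * (q 1 - p 1) < 0 := mul_neg_of_pos_of_neg (by linarith) (by linarith)
    linarith
  have hτ2 : τ ≤ t₂ := by
    by_contra hh
    push Not at hh
    have ha := chart_dotProduct_sub_affine σ t₂ τ q p
    have : (t₂ - τ) * (q 1 - p 1) > 0 := mul_pos_of_neg_of_neg (by linarith) (by linarith)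
    linarith
  refine ⟨(τ, ![σ, τ] ⬝ᵥ p), ⟨?_, ?_⟩, hτ1, hτ2⟩
  · have hqp : q ≠ p := fun h => by rw [h] at hqs; exact lt_irrefl _ hqs
    have hsub : ({q, p} : Finset (Fin 2 → ℝ)) ⊆ tied σ F τ (![σ, τ] ⬝ᵥ p) := by
      intro y hy
      rw [Finset.mem_insert, Finset.mem_singleton] at hy
      rw [tied, Finset.mem_filter]
      rcases hy with rfl | rfl
      · exact ⟨hqF, htie⟩
      · exact ⟨hp, rfl⟩
    have := Finset.card_le_card hsub
    rw [Finset.card_pair hqp] at this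
    exact this
  · -- everything above `p` at `τ` is still above at `t₂`
    have hsub : above σ F τ (![σ, τ] ⬝ᵥ p) ⊆ S₂ := by
      intro y hy
      obtain ⟨hyF, hylt⟩ := Finset.mem_filter.1 hy
      by_contra hy2
      have hle2 : ![σ, t₂] ⬝ᵥ y ≤ ![σ, t₂] ⬝ᵥ p := by
        by_contra hh
        exact hy2 (Finset.mem_filter.2 ⟨hyF, lt_of_not_ge hh⟩)
      -- `y` crosses `p` downwards strictly after `τ`, hence belongs to `D` with a larger crossing time
      have ha := chart_dotProduct_sub_affine σ t₂ τ y p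
      have hys : y 1 < p 1 := by
        by_contra hh
        push Not at hh
        have : 0 ≤ (t₂ - τ) * (y 1 - p 1) := mul_nonneg (by linarith) (by linarith)
        linarith
      have hys' : y 1 ≠ p 1 := ne_of_lt hys
      have ha1 := chart_dotProduct_sub_affine σ t₁ τ y p
      have hy1 : ![σ, t₁] ⬝ᵥ p < ![σ, t₁] ⬝ᵥ y := by
        have : 0 ≤ (t₁ - τ) * (y 1 - p 1) := mul_nonneg_of_nonpos_of_nonpos (by linarith) (by linarith)
        linarith
      have hyD : y ∈ D := Finset.mem_filter.2 ⟨Finset.mem_filter.2 ⟨hyF, hy1⟩, hy2⟩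
      have hmax := hqmax y hyD
      have hcy := chart_eq_at_crossT σ hys'
      have ha3 := chart_dotProduct_sub_affine σ τ (crossT σ y p) y p
      have hgt : τ < crossT σ y p := by
        by_contra hh
        push Not at hh
        have h0 : (τ - crossT σ y p) * (y 1 - p 1) ≤ 0 := mul_nonpos_of_nonneg_of_nonpos (by linarith) (by linarith)
        linarith
      exact absurd hmax (not_le.2 hgt)
    exact lt_of_le_of_lt (Finset.card_le_card hsub) hc2

/-- **Top-`k` sets change only at low events**: if `topSet σ F k t₁ ≠ topSet σ F k t₂` for `t₁ ≤ t₂`, then some low tie event of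
order `< k` happens at a time in `[t₁, t₂]`.  So along the chart the top-`k` set takes at most `1 + #lowEvents` values. [folklore] -/
theorem exists_lowEvent_of_topSet_ne {k : ℕ} {t₁ t₂ : ℝ} (h12 : t₁ ≤ t₂) (hne : topSet σ F k t₁ ≠ topSet σ F k t₂) :
    ∃ e : ℝ × ℝ, IsLowEvent σ F k e ∧ t₁ ≤ e.1 ∧ e.1 ≤ t₂ := by
  classical
  obtain ⟨p, hp⟩ : ∃ p, ¬ (p ∈ topSet σ F k t₁ ↔ p ∈ topSet σ F k t₂) := by
    by_contra h
    push Not at h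
    exact hne (Finset.ext h)
  simp only [topSet, Finset.mem_filter] at hp
  by_cases h1 : p ∈ F ∧ rank σ F t₁ p < k
  · have h2 : ¬ (rank σ F t₂ p < k) := fun h2 => hp ⟨fun _ => ⟨h1.1, h2⟩, fun _ => h1⟩
    exact exists_lowEvent_of_rank_lt_of_le h12 h1.1 h1.2 (not_lt.1 h2)
  · have h2 : p ∈ F ∧ rank σ F t₂ p < k := by
      by_contra h2
      exact hp ⟨fun h => absurd h h1, fun h => absurd h h2⟩
    have h1' : ¬ (rank σ F t₁ p < k) := fun h => h1 ⟨h2.1, h⟩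
    exact exists_lowEvent_of_le_of_rank_lt h12 h2.1 (not_lt.1 h1') h2.2

end TopSets

end TotalsLaw

end Summit.ValiantsHypothesis.ValiantsHypothesis.Theorems.NewtonUnitEquationsDissociatedUniform
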